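import Literature.MathematicalPhysics.QuantumFieldTheory.Balaban1983to89.B9Eq3117LaplaceDerivCommutator
import Literature.MathematicalPhysics.QuantumFieldTheory.Balaban1983to89.B11Eq103H1Complex

/-!
# `Balaban1983to89.B9Eq344HessianRowDecomposition` — T. Bałaban, *Propagators for lattice gauge theories in a background field*, Commun. Math. Phys. **99** (1985)
# 389–434 [Balaban1985BackgroundPropagators] Thm 3.1 (3.44) p. 398, (3.23) p. 394, (3.117) p. 419, Thm 3.13 p. 426: **THE COVARIANT HESSIAN ROW OF A SOLUTION OF
# `Δ^η_Uu = ω`, DECOMPOSED THROUGH THE MASSIVE RESOLVENT `(Δ^η_U + 1)⁻¹` — `(D_Uu)_μ = (Δ^η_U+1)⁻¹D*_U(A_ω) + (Δ^η_U+1)⁻¹(Comm_μ(u) + (D_Uu)_μ)`, where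
# `A_ω(y,κ) = −δ_{κμ}R_{y,μ}ω(y+e_μ)` (so that `(D_Uω)(·,μ) = D*_U(A_ω)` EXACTLY) and `Comm_μ(u)` is the two-plaquette sum of `B9Eq3117LaplaceDerivCommutator`.**
# This is the algebraic step of this lineage's route to STOREY H's `H3` (the covariant Hessian row of `u = G′_kω`, `ω = R_kG′_kD*_Uf`, which solves `Δ^η_Uu = ω` by
# `B9Eq325GreenPrimeOnProjRange`): after it, `D_U(D_Uu)_μ = [D_U(Δ^η_U+1)⁻¹D*_U](A_ω) + [D_U(Δ^η_U+1)⁻¹](Comm_μ(u) + (D_Uu)_μ)` is bounded by the two LANDED letters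
# `B9Eq344ResolventGradientRowTower.exists_gradRow_resolvent_covDiv_holder` ((3.44)-shape, on η-Hölder data) and `B9Eq342ResolventGradLetterTower.exists_gradLetter_resolvent`
# (on sup data) together with `B9Eq3117CommutatorBound` (the bound on `Comm_μ` from the plaquette window and (3.36)).  NE9 crux-team LEAF PROVER 01, gen 95.

statement-level skeleton of published theorems with citation tags; proofs where landed; nothing here is a claim about the Yang–Mills mass gap

CITATION HEADER (lean-in-tree rule).  Audit cell `pub-balaban`, sub-cell `t4`, BINDER row NE9; filed by NE9 crux-team LEAF PROVER 01 (`b2b-balaban-t4-ne9-formalise-leaf-01`,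
gen 95; bears_on: R4/N22).  Source READ first-hand (`paper:balaban1985-cmp99-background-propagators`, pp. 394, 398, 419, 426).  The CONTENT is [folklore] finite algebra:
(3.3)∕(3.8) (`B9Eq33CovDerivVector.covDeriv`∕`covDiv`, generic transporters `R`, `S` with `S_bR_b = 1`), (3.23) (`B11Eq103H1Complex.covLaplaceSiteK = D*∘D`), the inverse
`B11Eq103H1Complex.greenK` of a positive operator, and this lineage's exact commutator `B9Eq3117LaplaceDerivCommutator.laplace_covDeriv_sub_covDeriv_laplace` BY NAME.
Nothing printed is a hypothesis.

WHAT IS PROVED (sorry-free; proof lane — 0 `def`).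
* §1 `covDeriv_dir_eq_covDiv` — `(D_Rω)(·,μ) = D*_S(A_ω)` with `A_ω(y,κ) = −δ_{κμ}·R_{y,μ}ω(y+e_μ)`, for `S_bR_b = 1` (generic scalars `𝕜`, module `V`).
* §2 `laplace_add_one_hessSlice_eq` — for `Δ_{RS}u = ω` (as `SiteL2K` vectors): `(Δ_{RS} + 1)w_μ = D*_S(A_ω) + (Comm_μ(u) + w_μ)`, `w_μ := (D_Ru)(·,μ)` read as a site vector;
  **`hessSlice_eq_greenK_add`** — hence, for `Δ_{RS} + 1` positive, `w_μ = (Δ_{RS}+1)⁻¹D*_S(A_ω) + (Δ_{RS}+1)⁻¹(Comm_μ(u) + w_μ)`, and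
  **`covDeriv_hessSlice_eq`** — `D_Rw_μ = D_R(Δ_{RS}+1)⁻¹D*_S(A_ω) + D_R(Δ_{RS}+1)⁻¹(Comm_μ(u) + w_μ)` (the form the two letters consume).
HONEST SCOPE.  [folklore] algebra; no estimate; NOT summit progress (cell pub-balaban: NE9 NOT PRINTED ∕ NOT PROVED; «NE9 ⇐ the named binders»; row WALLED ON A MODEL (O-NE9-1;
#5 UNRULED); spine PROVED 0∕9; rung (B)+1 finite T⁴ — NOT infinite volume, NOT mass gap, NOT BetaPertH, NOT Clay).  NEW file; nothing modified.  Net new unproved facts: 0.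
-/

noncomputable section

open scoped BigOperators InnerProductSpace

namespace Literature.MathematicalPhysics.QuantumFieldTheory.Balaban1983to89.B9Eq344HessianRowDecomposition

open B4Sect5Torus (TSite)
open B9SectCLatticeCarrier (Bond shift unshift shift_unshift)
open B9Eq311L2Pairing (WL2)
open B9Eq33CovDerivVector (covDeriv covDiv covDeriv_apply_dir covDiv_apply)
open B11Eq103H1Complex (SiteL2K BondL2K covDerivL2K covDivL2K covLaplaceSiteK greenK greenK_apply equiv_covDerivL2K equiv_covDivL2K)
open B9Eq3117LaplaceDerivCommutator (laplace_covDeriv_sub_covDeriv_laplace)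

/-! ## §1 `(D_Rω)(·,μ) = D*_S(A_ω)` -/

section Generic

variable {d : ℕ} {Pd : Fin d → ℕ} {𝕜 : Type*} [CommRing 𝕜] {V : Type*} [AddCommGroup V] [Module 𝕜 V]

/-- **`(D_Rω)(x,μ) = (D*_SA_ω)(x)`, `A_ω(y,κ) = −δ_{κμ}·R_{y,μ}ω(y+e_μ)`** (`S_bR_b = 1`): `D*_SA(x) = c·Σ_κ(S_{x−e_κ,κ}A(x−e_κ,κ) − A(x,κ))`, only `κ = μ` contributes,
`S_{x−e_μ,μ}(−R_{x−e_μ,μ}ω(x)) = −ω(x)` and `−A(x,μ) = R_{x,μ}ω(x+e_μ)`. [folklore] [cite: Balaban1985BackgroundPropagators, (3.3) p.391, (3.8) p.392] -/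
theorem covDeriv_dir_eq_covDiv (c : 𝕜) (R S : Bond d Pd → V →ₗ[𝕜] V) (hSR : ∀ b w, S b (R b w) = w) (ω : TSite d Pd → V) (μ : Fin d) (x : TSite d Pd) :
    covDeriv c R ω (x, μ) = covDiv c S (fun b => if b.2 = μ then -(R (b.1, μ) (ω (shift μ b.1))) else 0) x := by
  rw [covDeriv_apply_dir, covDiv_apply]
  congr 1
  rw [Finset.sum_eq_single μ]
  · simp only [if_true, shift_unshift, map_neg, hSR]
    abel
  · intro κ _ hκ
    simp only [hκ, if_false, map_zero, sub_zero]
  · intro h; exact absurd (Finset.mem_univ μ) h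

end Generic

/-! ## §2 The decomposition of the Hessian slice through `(Δ_{RS} + 1)⁻¹` -/

section L2

variable {d : ℕ} {Pd : Fin d → ℕ} {W : Type*} [NormedAddCommGroup W] [InnerProductSpace ℂ W] [FiniteDimensional ℂ W] {c₀ : ℝ} [Fact (0 < c₀)]

omit [FiniteDimensional ℂ W] in
/-- **`(Δ_{RS} + 1)w_μ = D*_S(A_ω) + (Comm_μ(u) + w_μ)` when `Δ_{RS}u = ω`**, `w_μ = (D_Ru)(·,μ)` as a site vector, `A_ω(y,κ) = −δ_{κμ}R_{y,μ}ω(y+e_μ)`, `Comm_μ(u)` the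
two-plaquette sum of `laplace_covDeriv_sub_covDeriv_laplace`. [folklore] [cite: Balaban1985BackgroundPropagators, (3.23) p.394, (3.117) p.419, Thm 3.1 (3.44) p.398] -/
theorem laplace_add_one_hessSlice_eq (c : ℂ) (R S : Bond d Pd → W →ₗ[ℂ] W) (hSR : ∀ b w, S b (R b w) = w) (u ω : SiteL2K ℂ d Pd c₀ W)
    (hEq : covLaplaceSiteK (c₀ := c₀) c R S u = ω) (μ : Fin d) :
    ((covLaplaceSiteK (c₀ := c₀) c R S + (1 : ℂ) • LinearMap.id : SiteL2K ℂ d Pd c₀ W →ₗ[ℂ] SiteL2K ℂ d Pd c₀ W))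
        ((WL2.equiv ℂ (fun _ : TSite d Pd => c₀) W).symm fun y => WL2.equiv ℂ (fun _ : Bond d Pd => c₀) W (covDerivL2K ℂ c₀ c R u) (y, μ)) =
      covDivL2K ℂ c₀ c S ((WL2.equiv ℂ (fun _ : Bond d Pd => c₀) W).symm fun b =>
          if b.2 = μ then -(R (b.1, μ) (WL2.equiv ℂ (fun _ : TSite d Pd => c₀) W ω (shift μ b.1))) else 0) +
        (WL2.equiv ℂ (fun _ : TSite d Pd => c₀) W).symm fun x =>
          c • (c • (c • ∑ κ,
            ((R (x, μ) (R (shift μ x, κ) (WL2.equiv ℂ (fun _ : TSite d Pd => c₀) W u (shift κ (shift μ x)))) -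
                R (x, κ) (R (shift κ x, μ) (WL2.equiv ℂ (fun _ : TSite d Pd => c₀) W u (shift μ (shift κ x))))) +
             (R (x, μ) (S (unshift κ (shift μ x), κ) (WL2.equiv ℂ (fun _ : TSite d Pd => c₀) W u (unshift κ (shift μ x)))) -
                S (unshift κ x, κ) (R (unshift κ x, μ) (WL2.equiv ℂ (fun _ : TSite d Pd => c₀) W u (shift μ (unshift κ x)))))))) +
          WL2.equiv ℂ (fun _ : Bond d Pd => c₀) W (covDerivL2K ℂ c₀ c R u) (x, μ) := by
  apply (WL2.equiv ℂ (fun _ : TSite d Pd => c₀) W).injective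
  funext x
  have hω : covDiv c S (covDeriv c R (WL2.equiv ℂ (fun _ : TSite d Pd => c₀) W u)) = WL2.equiv ℂ (fun _ : TSite d Pd => c₀) W ω := by
    rw [← hEq]; rfl
  have hX := laplace_covDeriv_sub_covDeriv_laplace c R S hSR (WL2.equiv ℂ (fun _ : TSite d Pd => c₀) W u) μ x
  rw [hω, covDeriv_dir_eq_covDiv c R S hSR _ μ x, sub_eq_iff_eq_add] at hX
  rw [LinearMap.add_apply, LinearMap.smul_apply, LinearMap.id_apply, one_smul, WL2.equiv_add, WL2.equiv_add, Pi.add_apply, Pi.add_apply,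
    equiv_covDivL2K]
  show covDiv c S (covDeriv c R fun y => WL2.equiv ℂ (fun _ : Bond d Pd => c₀) W (covDerivL2K ℂ c₀ c R u) (y, μ)) x + _ = _
  simp only [equiv_covDerivL2K, Equiv.apply_symm_apply]
  rw [hX]
  abel

/-- **THE DECOMPOSITION `w_μ = (Δ_{RS}+1)⁻¹D*_S(A_ω) + (Δ_{RS}+1)⁻¹(Comm_μ(u) + w_μ)`** for `Δ_{RS}u = ω` and `Δ_{RS} + 1` positive (`B11Eq103H1Complex.greenK`).
[folklore] [cite: Balaban1985BackgroundPropagators, (3.23) p.394, (3.117) p.419, Thm 3.1 (3.44) p.398, Thm 3.13 p.426] -/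
theorem hessSlice_eq_greenK_add (c : ℂ) (R S : Bond d Pd → W →ₗ[ℂ] W) (hSR : ∀ b w, S b (R b w) = w)
    (hpos₁ : ∀ z : SiteL2K ℂ d Pd c₀ W, z ≠ 0 →
      0 < RCLike.re ⟪z, ((covLaplaceSiteK (c₀ := c₀) c R S + (1 : ℂ) • LinearMap.id : SiteL2K ℂ d Pd c₀ W →ₗ[ℂ] SiteL2K ℂ d Pd c₀ W)) z⟫_ℂ)
    (u ω : SiteL2K ℂ d Pd c₀ W) (hEq : covLaplaceSiteK (c₀ := c₀) c R S u = ω) (μ : Fin d) :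
    ((WL2.equiv ℂ (fun _ : TSite d Pd => c₀) W).symm fun y => WL2.equiv ℂ (fun _ : Bond d Pd => c₀) W (covDerivL2K ℂ c₀ c R u) (y, μ)) =
      greenK _ hpos₁ (covDivL2K ℂ c₀ c S ((WL2.equiv ℂ (fun _ : Bond d Pd => c₀) W).symm fun b =>
          if b.2 = μ then -(R (b.1, μ) (WL2.equiv ℂ (fun _ : TSite d Pd => c₀) W ω (shift μ b.1))) else 0)) +
      greenK _ hpos₁ ((WL2.equiv ℂ (fun _ : TSite d Pd => c₀) W).symm fun x =>
          c • (c • (c • ∑ κ,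
            ((R (x, μ) (R (shift μ x, κ) (WL2.equiv ℂ (fun _ : TSite d Pd => c₀) W u (shift κ (shift μ x)))) -
                R (x, κ) (R (shift κ x, μ) (WL2.equiv ℂ (fun _ : TSite d Pd => c₀) W u (shift μ (shift κ x))))) +
             (R (x, μ) (S (unshift κ (shift μ x), κ) (WL2.equiv ℂ (fun _ : TSite d Pd => c₀) W u (unshift κ (shift μ x)))) -
                S (unshift κ x, κ) (R (unshift κ x, μ) (WL2.equiv ℂ (fun _ : TSite d Pd => c₀) W u (shift μ (unshift κ x)))))))) +
          WL2.equiv ℂ (fun _ : Bond d Pd => c₀) W (covDerivL2K ℂ c₀ c R u) (x, μ)) := by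
  rw [← map_add, ← laplace_add_one_hessSlice_eq c R S hSR u ω hEq μ, greenK_apply]

/-- **THE HESSIAN ROW THROUGH THE RESOLVENT: `D_Rw_μ = D_R(Δ_{RS}+1)⁻¹D*_S(A_ω) + D_R(Δ_{RS}+1)⁻¹(Comm_μ(u) + w_μ)`** — the left side is the covariant Hessian slice
`D_R((D_Ru)(·,μ))` of the solution of `Δ_{RS}u = ω`; the first summand is the (3.44)-shaped word on the Hölder data `A_ω`, the second the gradient of the resolvent on sup data.
[folklore] [cite: Balaban1985BackgroundPropagators, Thm 3.1 (3.44) p.398, (3.117) p.419, Thm 3.13 p.426] -/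
theorem covDeriv_hessSlice_eq (c : ℂ) (R S : Bond d Pd → W →ₗ[ℂ] W) (hSR : ∀ b w, S b (R b w) = w)
    (hpos₁ : ∀ z : SiteL2K ℂ d Pd c₀ W, z ≠ 0 →
      0 < RCLike.re ⟪z, ((covLaplaceSiteK (c₀ := c₀) c R S + (1 : ℂ) • LinearMap.id : SiteL2K ℂ d Pd c₀ W →ₗ[ℂ] SiteL2K ℂ d Pd c₀ W)) z⟫_ℂ)
    (u ω : SiteL2K ℂ d Pd c₀ W) (hEq : covLaplaceSiteK (c₀ := c₀) c R S u = ω) (μ : Fin d) :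
    covDerivL2K ℂ c₀ c R ((WL2.equiv ℂ (fun _ : TSite d Pd => c₀) W).symm fun y => WL2.equiv ℂ (fun _ : Bond d Pd => c₀) W (covDerivL2K ℂ c₀ c R u) (y, μ)) =
      covDerivL2K ℂ c₀ c R (greenK _ hpos₁ (covDivL2K ℂ c₀ c S ((WL2.equiv ℂ (fun _ : Bond d Pd => c₀) W).symm fun b =>
          if b.2 = μ then -(R (b.1, μ) (WL2.equiv ℂ (fun _ : TSite d Pd => c₀) W ω (shift μ b.1))) else 0))) +
      covDerivL2K ℂ c₀ c R (greenK _ hpos₁ ((WL2.equiv ℂ (fun _ : TSite d Pd => c₀) W).symm fun x =>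
          c • (c • (c • ∑ κ,
            ((R (x, μ) (R (shift μ x, κ) (WL2.equiv ℂ (fun _ : TSite d Pd => c₀) W u (shift κ (shift μ x)))) -
                R (x, κ) (R (shift κ x, μ) (WL2.equiv ℂ (fun _ : TSite d Pd => c₀) W u (shift μ (shift κ x))))) +
             (R (x, μ) (S (unshift κ (shift μ x), κ) (WL2.equiv ℂ (fun _ : TSite d Pd => c₀) W u (unshift κ (shift μ x)))) -
                S (unshift κ x, κ) (R (unshift κ x, μ) (WL2.equiv ℂ (fun _ : TSite d Pd => c₀) W u (shift μ (unshift κ x)))))))) +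
          WL2.equiv ℂ (fun _ : Bond d Pd => c₀) W (covDerivL2K ℂ c₀ c R u) (x, μ))) := by
  rw [← map_add, ← hessSlice_eq_greenK_add c R S hSR hpos₁ u ω hEq μ]

end L2

end Literature.MathematicalPhysics.QuantumFieldTheory.Balaban1983to89.B9Eq344HessianRowDecomposition

end
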